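import Literature.AnabelianGeometry.AbsoluteAnabelian.AbsTopIII.BiAnabelianCompatibility

/-!
# [AbsTopIII] Corollary 3.7 (v), final sentence — SUCCESSOR statement (the Cor. 3.6 split)

S. Mochizuki, *Topics in Absolute Anabelian Geometry III*, Cor. 3.7 (v) p. 88 l. 52–54 of the kurims manuscript
(`paper:url-5493eb38cbb7`; bib key `MochizukiAbsTopIII2015`), read on the page: "Finally, the self-equivalences
in these nexus-classes are compatible with `ℋ_δ` [cf. (ii)], as well as with the families of homotopies that
constitute the cores, telecore, and observable of (i), (ii), (iii)"; and (iv), second sentence, l. 43–46: "the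
telecore structure `𝔗_δ` of (ii), the family of homotopies `ℋ_δ` of (ii), and the observable `𝔖†_log` of (iii)
are not simultaneously compatible".  Seat abc-iut-L4-t5 (gen 6).  STATEMENTS ONLY (typed, NOT proved).

WHY A SUCCESSOR (finding F-L4t5g6-1 «COR37v-REALISESALL», self-reported by the typer of record): the gen-5
statement `ShiftCompatStmt θ` of `BiAnabelianCompatibility.lean` quantifies ONE family `K` on `𝒟*` with
`RealisesAll θ K` — `K` contains the `𝔖†_log` family, the core families, the telecore family `𝒥` of a telecore
`𝔗_δ` of the printed shape AND the family `ℋ_δ`.  By (iv), second sentence (abc-iut-L4-t9's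
`TelecoreIncompatibleStmt θ`, which HOLDS at the MLF model, `TFModel.telecoreIncompatibleStmt_holds`), no such
`K` exists at print's data, so `ShiftCompatStmt θ` as typed is unsatisfiable there, whereas print (v) asks for
compatibility of the self-equivalences with EACH of the named families (Def. 3.5 (v) is a condition on an
equivalence of diagrams relative to one family of homotopies at a time).  The successor below is the split the
tree already uses for the "entirely similar" Cor. 3.6 (v) (`LogFrobeniusData.ShiftCompatStmt` = sentence 3:
cores + observable; `ShiftTelecoreCompatStmt τ` = sentence 4: telecore + contact structure):

* `RealisesCoresLogObsTele K` — the (iii) collection in one family: `𝔖†_log`, the cores of (i)/(ii) and the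
  telecore family `𝒥` ((iii), second clause, says exactly that these are compatible; consistent);
* `RealisesTeleDelta θ K'` — the telecore family `𝒥` together with `ℋ_δ`, whose restriction is the contact
  structure of `𝔗_δ` ((ii); consistent);
* `ShiftCompatStmt′ θ` — ONE `ℤ`-action `Φ` (`IsShiftAction`), every `Φ_m` compatible (Def. 3.5 (v),
  abc-iut-L4-t2's `OneMorphism.CompatibleWith`) with a family of the first kind AND with a family of the second
  kind.  `shiftCompatStmt'_of_shiftCompatStmt` records that the successor is WEAKER than the gen-5 statement.

Everything typed by abc-iut-L4-t9 / t12 is consumed BY NAME (`IsTelecoreDelta`, `embTele`, `DeltaGen`,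
`DeltaPinned`, `IsShiftAction`, `RealisesCoresAndLogObs`); nothing is re-declared.  HONEST FRAMING: refereed
pre-IUT material; per-setting `Prop`s, not asserted; refuted-as-typed ≠ refuted-in-print; nothing here bears on
[IUTchIII] Cor. 3.12.
-/

namespace Literature.AnabelianGeometry.AbsoluteAnabelian.AbsTopIII

open CategoryTheory Quiver
open Literature.AnabelianGeometry.AbsoluteAnabelian.DiagramOfCategories

universe u

namespace BiAnabelianSetting

variable {X E N : Type u} [Category.{u} X] [Category.{u} E] [Category.{u} N]
  (𝔖 : BiAnabelianSetting X E N)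

/-- **The (iii) collection in ONE family**: `K` on `𝒟*` contains (Def. 3.5 (ii), along the embeddings) the
`𝔖†_log` family, the core families of (i), (ii) (`RealisesCoresAndLogObs K`) AND the telecore family `𝒥` of a
telecore `𝔗_δ` of the printed shape — "[`𝔖†_log`] is compatible with the families of homotopies that constitute
the core and telecore structures of (i), (ii)". [cite: MochizukiAbsTopIII2015, Cor 3.7 (iii) p.88] -/
def RealisesCoresLogObsTele (K : 𝔖.starDiagram.HomotopyFamily) : Prop :=
  𝔖.RealisesCoresAndLogObs K ∧
    ∃ H₁ hH₁ hc, ∃ T : (𝔖.daggerLe 1).Telecore (𝔖.refCoreObs H₁ hH₁) hc,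
      𝔖.IsTelecoreDelta T ∧ T.Jfam.CompatibleAlong (embTele T) K

/-- **The telecore `𝔗_δ` together with `ℋ_δ` in ONE family**: `K'` on `𝒟*` contains (along `𝒟‡_δ ↪ 𝒟*`) the
family `𝒥` of a telecore of the printed shape and a family `ℋ_δ` generated by `DeltaGen` with the printed
homotopies (`DeltaPinned θ`) — consistent: "[`ℋ_δ` gives] by restriction, a contact structure on the telecore
`𝔗_δ`" (a contact structure is by definition compatible with `𝒥`, Def. 3.5 (iv)).
[cite: MochizukiAbsTopIII2015, Cor 3.7 (ii) p.88] -/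
def RealisesTeleDelta (θ : FiberSquare.BiAnabelianLift 𝔖.gal) (K' : 𝔖.starDiagram.HomotopyFamily) :
    Prop :=
  (∃ H₁ hH₁ hc, ∃ T : (𝔖.daggerLe 1).Telecore (𝔖.refCoreObs H₁ hH₁) hc,
      𝔖.IsTelecoreDelta T ∧ T.Jfam.CompatibleAlong (embTele T) K') ∧
    (∃ Hδ : 𝔖.starDiagram.HomotopyFamily, HomotopyFamily.IsGeneratedBy _ Hδ DeltaGen.{u} ∧
      𝔖.DeltaPinned θ Hδ ∧ Hδ.CompatibleAlong (𝟭q Cor37Vertex) K')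

/-- **Cor. 3.7 (v), final sentence — SUCCESSOR of `ShiftCompatStmt θ`** (finding F-L4t5g6-1; see the module
docstring): "the self-equivalences in these nexus-classes are compatible with `ℋ_δ` [cf. (ii)], as well as with
the families of homotopies that constitute the cores, telecore, and observable of (i), (ii), (iii)" — for ONE
`ℤ`-action `Φ` of (v), every `Φ_m` is Def. 3.5 (v)-compatible with a family realising the (iii) collection
(`RealisesCoresLogObsTele`) AND with a family realising `𝔗_δ` and `ℋ_δ` (`RealisesTeleDelta θ`).  The two families
are NOT merged: by (iv), second sentence, `𝔗_δ`, `ℋ_δ`, `𝔖†_log` are not simultaneously compatible.  This is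
the split of the tree's Cor. 3.6 (v) typing (`ShiftCompatStmt` / `ShiftTelecoreCompatStmt τ`), to whose proof
print refers ("entirely similar").  Per-setting `Prop`. [cite: MochizukiAbsTopIII2015, Cor 3.7 (v) p.88] -/
def ShiftCompatStmt' (θ : FiberSquare.BiAnabelianLift 𝔖.gal) : Prop :=
  ∃ Φ : ℤ → 𝔖.starDiagram.SelfEquivalence, 𝔖.IsShiftAction Φ ∧
    (∃ K : 𝔖.starDiagram.HomotopyFamily,
      𝔖.RealisesCoresLogObsTele K ∧ ∀ m : ℤ, Nonempty ((Φ m).hom.CompatibleWith K K)) ∧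
    (∃ K' : 𝔖.starDiagram.HomotopyFamily,
      𝔖.RealisesTeleDelta θ K' ∧ ∀ m : ℤ, Nonempty ((Φ m).hom.CompatibleWith K' K'))

variable {𝔖}

/-- `RealisesAll θ K` is exactly "`K` realises the (iii) collection AND `K` realises `𝔗_δ` with `ℋ_δ`" for the
SAME `K` (the joint witness that (iv) forbids at print's data). [cite: MochizukiAbsTopIII2015, Cor 3.7 (v) p.88] -/
theorem realisesAll_iff (θ : FiberSquare.BiAnabelianLift 𝔖.gal) (K : 𝔖.starDiagram.HomotopyFamily) :
    𝔖.RealisesAll θ K ↔ 𝔖.RealisesCoresLogObsTele K ∧ 𝔖.RealisesTeleDelta θ K :=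
  ⟨fun h => ⟨⟨h.1, h.2.1⟩, ⟨h.2.1, h.2.2⟩⟩, fun h => ⟨h.1.1, h.1.2, h.2.2⟩⟩

/-- **The successor is WEAKER than the gen-5 statement**: a joint witness `K` serves as both `K` and `K'`.
[cite: MochizukiAbsTopIII2015, Cor 3.7 (v) p.88] -/
theorem shiftCompatStmt'_of_shiftCompatStmt (θ : FiberSquare.BiAnabelianLift 𝔖.gal)
    (h : 𝔖.ShiftCompatStmt θ) : 𝔖.ShiftCompatStmt' θ := by
  obtain ⟨Φ, K, hΦ, hK, hc⟩ := h
  exact ⟨Φ, hΦ, ⟨K, ((realisesAll_iff θ K).1 hK).1, hc⟩, ⟨K, ((realisesAll_iff θ K).1 hK).2, hc⟩⟩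

/-- The (iii)-collection conjunct contains the (iii)-core conjunct. [cite: MochizukiAbsTopIII2015, Cor 3.7 (iii) p.88] -/
theorem RealisesCoresLogObsTele.realisesCoresAndLogObs {K : 𝔖.starDiagram.HomotopyFamily}
    (h : 𝔖.RealisesCoresLogObsTele K) : 𝔖.RealisesCoresAndLogObs K := h.1

/-- A family realising the (iii) collection witnesses BOTH typed halves of (iii), second clause
(`LogObsCompatCoresStmt`, `LogObsCompatTelecoreStmt`). [cite: MochizukiAbsTopIII2015, Cor 3.7 (iii) p.88] -/
theorem RealisesCoresLogObsTele.logObsCompat {K : 𝔖.starDiagram.HomotopyFamily}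
    (h : 𝔖.RealisesCoresLogObsTele K) : 𝔖.LogObsCompatCoresStmt ∧ 𝔖.LogObsCompatTelecoreStmt := by
  obtain ⟨hK, H₁, hH₁, hc, T, hT, hJ⟩ := h
  exact ⟨⟨K, hK⟩, ⟨H₁, hH₁, hc, T, hT, K, hJ, hK.1⟩⟩

end BiAnabelianSetting

end Literature.AnabelianGeometry.AbsoluteAnabelian.AbsTopIII
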